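import Summits.QuantumFields.YangMills.Theorems.BalabanUVNodesN08AlphaProfileRegular

/-!
# Route «BalabanUVNodes», Track-A DAG node N08 = [Balaban1985UV3] — (α) clause, the in-edge sentence (b11‴) CONSTRUCTED, part 5d:
# THE PROFILE OF A HISTORY IS `h`-LARGE — and the sentence (b11‴) as a THEOREM: regular `h`-large profiles EXIST

Cell `pub-ymgap`, seat `pub-ymgap-dag-n08-d` gen 5, file F5d (over F5c `…ProfileRegular`).  `bears_on: R4∕N08`; filed `--supports stmt-QuantumFields-19910 --as helper`.
Sorry-free, standard axioms.

THE LARGENESS (★ `hLarge_prof`).  Let `p′ ∈ P_j(h)` be a recorded plaquette (`j < k ≤ K`, `h` admissible), `z` its integer position.  Every fine site of the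
four corner blocks `Δ′(p′)` projects into `plaqCover p′ ⊂ Λ_j(h)` (`TorusLift.projSite_mem_plaqCover`), where — by the collar (39) and F4 — the cut-off
weights are `ω_j = 1`, `ω_{j′} = 0` (`j′ ≠ j`) up to fine distance `2`; so on `Δ′(p′)` the blended potential has EXACTLY the curl of the scale-`j` pattern
(F5a `curl_blend_eq_of_local`).  Hence (i) the dependency cones of the four bonds of `∂p′` are tame (F5a's sharp budget with `|curl| ≤ amp j`:
`3·L²·(L^{j−1})²·amp j·‖X‖ = ¾·C68·g_jp(g_j) < log 2`), so [4]'s `j`-fold average of the lift is the abelian configuration of the `j`-fold LINEAR average at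
those bonds (F2 `avgIter_abelCfg`) and `Ū^j(∂p′) = exp(curl(linAvgIter potZ j)(z)·X)`; (ii) by the window locality (F2b) and F3, `|curl(linAvgIter potZ j)(z)| =
amp j·((L^j)²+1)/2 ≥ amp j·L^{2j}/2 = C68·g_jp(g_j)/(8‖X‖)`; (iii) by F1's lower bound `‖exp(tX) − 1‖ ≥ (2/π)|t|‖X‖`, `|Ū^j(∂p′) − 1| ≥ C68·g_jp(g_j)/(4π) ≥
g_jp(g_j)` as soon as `C68 ≥ 4π`.
★ `exists_regular_hLarge_profile` — (b11‴) AS A THEOREM: under the STRUCTURAL hypotheses `X ∈ 𝔤 ∖ 0`, `C68 ≥ 4π`, `C68·g_jp(g_j) ≤ ¼` (`j < K`) and collars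
`⌈R₁r(g_j)⌉M₁ ≥ 14` (`j < K`), every admissible history `h` of `k ≤ K` steps is exhibited by a configuration of [7]'s closed regular class `regClassC 𝔊 𝔠 k h`
whose lifted `j`-fold averages are `h`-LARGE (`HLarge`).
HONEST FRAMING: a kernel CONSTRUCTION (test configurations); nothing of [B10] ∕ [7] ∕ [4]'s estimates asserted; count-neutral; NOT a discharge of N08.  d = 3
lattice gauge theory on finite tori as printed; nothing about d = 4, the continuum, OS axioms, a mass gap or the Clay problem.
-/

noncomputable section

namespace Summit.QuantumFields.YangMills.Theorems.BalabanUVNodesN08AlphaProfileLarge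

open scoped BigOperators Matrix.Norms.L2Operator
open NormedSpace
open Literature.MathematicalPhysics.QuantumFieldTheory.Balaban1983to89
open Literature.MathematicalPhysics.QuantumFieldTheory.Balaban1983to89.B10 (pFun)
open Literature.MathematicalPhysics.QuantumFieldTheory.Balaban1985CMP102
open Literature.MathematicalPhysics.QuantumFieldTheory.Balaban1985CMP102.Setting
open Summit.QuantumFields.Balaban3D.Carriers
open Summit.QuantumFields.Balaban3D.Proofs.Primitives (AlphaConsts)
open Summit.QuantumFields.Balaban3D.Proofs.LiftBridge (liftCfg)
open Summit.QuantumFields.Balaban3D.Proofs.TorusLift (projSite projSite_add_e zOf projSite_mem_plaqCover)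
open Summit.QuantumFields.Balaban3D.Proofs.Run3Collar (tdist_shift_le)
open Summit.QuantumFields.Balaban3D.Proofs.Run3SmallFactors (codeZ)
open Summit.QuantumFields.Balaban3D.Proofs.AdmissibleRegions (plaqCover_subset_of_admissible)
open Summit.QuantumFields.YangMills.Theorems.BalabanUVNodesN08AlphaClassI (HLarge)
open Summit.QuantumFields.YangMills.Theorems.BalabanUVNodesN08AlphaCompactSel (regClassC)
open Summit.QuantumFields.YangMills.Theorems.BalabanUVNodesN08AlphaAbelianLift
open Summit.QuantumFields.YangMills.Theorems.BalabanUVNodesN08AlphaAbelianAverage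
open Summit.QuantumFields.YangMills.Theorems.BalabanUVNodesN08AlphaAbelianWindow
open Summit.QuantumFields.YangMills.Theorems.BalabanUVNodesN08AlphaAbelianCone
open Summit.QuantumFields.YangMills.Theorems.BalabanUVNodesN08AlphaPattern
open Summit.QuantumFields.YangMills.Theorems.BalabanUVNodesN08AlphaHistGeom
open Summit.QuantumFields.YangMills.Theorems.BalabanUVNodesN08AlphaBlend
open Summit.QuantumFields.YangMills.Theorems.BalabanUVNodesN08AlphaProfileBuild
open Summit.QuantumFields.YangMills.Theorems.BalabanUVNodesN08AlphaProfileRegular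
open B3Taylor310LocalRemainder (tdist_comm tdist_triangle)
open B7Prop1Explicit (e e_apply hol plaqWord expUnit val_expUnit)
open B7Prop2Explicit (avgIter)
open B10Eq70Squaring (deltaBox mem_deltaBox side)

variable {L : ℕ} (S : Scales L) {G : Type} [GaugeGroup G] [MeasurableSpace G] {𝔊 : GroupModel G} (𝔠 : AlphaConsts L 𝔊.N)

/-! ## §1 Near a recorded plaquette the blend IS the scale-`j` pattern -/

section Local

variable (X : Matrix (Fin 𝔊.N) (Fin 𝔊.N) ℂ) {k : ℕ} (h : Hist S.P k)

/-- **THE WEIGHTS NEAR THE COVER OF A RECORDED PLAQUETTE**: for `p′ ∈ P_j(h)` (`h` admissible, collars `≥ 14`), `x₀ ∈ plaqCover p′` and `tdist x₀ y ≤ 2`: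
`ω_j(y) = 1` and `ω_{j′}(y) = 0` for `j′ ≠ j`. [cite: Balaban1985UV3, (39) p.266 + p.273 L14] -/
theorem wgt_near_cover (hk : k ≤ S.K) (hR : CollarOK S 𝔠 k)
    (hadm : Hist.Admissible 𝔠.lane.carrier.M₁ (rcolOf S 𝔠.lane.carrier) k h) {j : ℕ} (hj : j < k) {p : Plaq S.P j} (hp : p ∈ h ⟨j, hj⟩)
    {x₀ : Site S.P 0} (hx₀ : x₀ ∈ plaqCover p) {y : Site S.P 0} (hy : Site.tdist x₀ y ≤ 2) :
    wgt S 𝔠 h j y = 1 ∧ ∀ j', j' ≠ j → wgt S 𝔠 h j' y = 0 := by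
  have hkm : k ≤ S.P.m + S.P.K := le_trans hk (Nat.le_add_left _ _)
  have hR1 : 1 ≤ R0 := by norm_num [R0]
  obtain ⟨hΩ, -⟩ := plaqCover_subset_of_admissible 𝔠.lane.carrier.M₁ (rcolOf S 𝔠.lane.carrier) hadm hj hp hx₀
  -- `θ_{j'} = 1` for `j' ≤ j`, `θ_{j'} = 0` for `j' ≥ j + 1`
  have hone : ∀ j', j' ≤ j → Theta 𝔠.lane.carrier.M₁ (rcolOf S 𝔠.lane.carrier) R0 h j' y = 1 :=
    fun j' hj' => Theta_eq_one_of_near S 𝔠 h hkm hR hj hΩ hy hj'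
  have hzero : ∀ j', j + 1 ≤ j' → Theta 𝔠.lane.carrier.M₁ (rcolOf S 𝔠.lane.carrier) R0 h j' y = 0 := by
    intro j' hj'
    have h1 : Theta 𝔠.lane.carrier.M₁ (rcolOf S 𝔠.lane.carrier) R0 h (j + 1) y = 0 :=
      Theta_succ_eq_zero_near_bad _ _ R0 h rfl hkm hj hR1 (hR j hj) (Or.inl ⟨p, hp, hx₀⟩) hy
    have hanti := Theta_antitone 𝔠.lane.carrier.M₁ (rcolOf S 𝔠.lane.carrier) R0 h rfl hkm hR1 hR hj' y
    have hge := (Theta_mem 𝔠.lane.carrier.M₁ (rcolOf S 𝔠.lane.carrier) R0 h j' y).1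
    linarith
  refine ⟨?_, fun j' hj' => ?_⟩
  · unfold wgt; rw [hone j le_rfl, hzero (j + 1) le_rfl]; ring
  · unfold wgt
    rcases Nat.lt_or_gt_of_ne hj' with hlt | hgt
    · rw [hone j' hlt.le, hone (j' + 1) (by omega)]; ring
    · rw [hzero j' (by omega), hzero (j' + 1) (by omega)]; ring

/-- **ON `Δ′(p′)` THE BLEND HAS THE CURL OF THE SCALE-`j` PATTERN**: for `x ∈ deltaBox (L^j) (L^j • zOf p′) p′.μ p′.ν` and any directions `μ, ν`,
`curl potZ (x; μ,ν) = curl (patPot (L^j) (amp j)) (x; μ,ν)`. [cite: Balaban1985UV3, (69)–(70) p.273] -/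
theorem curl_potZ_eq_on_deltaBox (hk : k ≤ S.K) (hR : CollarOK S 𝔠 k)
    (hadm : Hist.Admissible 𝔠.lane.carrier.M₁ (rcolOf S 𝔠.lane.carrier) k h) {j : ℕ} (hj : j < k) {p : Plaq S.P j} (hp : p ∈ h ⟨j, hj⟩)
    {x : B7Prop1Explicit.Site S.P.d} (hx : x ∈ deltaBox (S.P.L ^ j) ((S.P.L ^ j : ℕ) • zOf p) p.μ p.ν) (μ ν : Fin S.P.d) :
    curl (potZ S 𝔠 X h) x μ ν = curl (patPot (L ^ j) (amp S 𝔠 X j)) x μ ν := by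
  have hkm : k ≤ S.P.m + S.P.K := le_trans hk (Nat.le_add_left _ _)
  have hx₀ : projSite x ∈ plaqCover p := projSite_mem_plaqCover (show j ≤ S.P.m + S.P.K by omega) p hx
  have h0 := wgt_near_cover S 𝔠 h hk hR hadm hj hp hx₀ (y := projSite x) (by rw [tdist_self']; omega)
  have hμ' := wgt_near_cover S 𝔠 h hk hR hadm hj hp hx₀ (y := projSite (x + e μ)) (by rw [projSite_add_e]; exact (tdist_shift_le _ μ).trans (by omega))
  have hν' := wgt_near_cover S 𝔠 h hk hR hadm hj hp hx₀ (y := projSite (x + e ν)) (by rw [projSite_add_e]; exact (tdist_shift_le _ ν).trans (by omega))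
  exact curl_blend_eq_of_local (projSite (P := S.P)) (wgt S 𝔠 h) (fun j => patPot (L ^ j) (amp S 𝔠 X j)) x μ ν hj
    ⟨h0.1, hμ'.1, hν'.1⟩ (fun j' _ hj' => ⟨h0.2 j' hj', hμ'.2 j' hj', hν'.2 j' hj'⟩)

/-- The cone boxes of the four bonds of the coarse plaquette at `zOf p′` and its window lie in `Δ′(p′)`. [cite: Balaban1985UV3, (69) p.273] -/
theorem mem_deltaBox_of_bounds {j : ℕ} (p : Plaq S.P j) {x : B7Prop1Explicit.Site S.P.d}
    (hx : ∀ i, (S.P.L : ℤ) ^ j * zOf p i ≤ x i ∧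
      x i ≤ (S.P.L : ℤ) ^ j * zOf p i + ((S.P.L : ℤ) ^ j - 1) + (if i = p.μ ∨ i = p.ν then (S.P.L : ℤ) ^ j else 0)) :
    x ∈ deltaBox (S.P.L ^ j) ((S.P.L ^ j : ℕ) • zOf p) p.μ p.ν := by
  rw [mem_deltaBox]
  intro κ
  have h1 := hx κ
  rw [Pi.sub_apply, Pi.smul_apply, nsmul_eq_mul]
  simp only [side]
  push_cast
  constructor
  · linarith [h1.1]
  · have h2 := h1.2
    split_ifs at h2 ⊢ <;> linarith

/-- `|curl potZ| ≤ amp j` on `Δ′(p′)`. [folklore] -/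
theorem abs_curl_potZ_le_on_deltaBox (hX0 : X ≠ 0) (hk : k ≤ S.K) (hR : CollarOK S 𝔠 k)
    (hadm : Hist.Admissible 𝔠.lane.carrier.M₁ (rcolOf S 𝔠.lane.carrier) k h) {j : ℕ} (hj : j < k) {p : Plaq S.P j} (hp : p ∈ h ⟨j, hj⟩)
    {x : B7Prop1Explicit.Site S.P.d} (hx : x ∈ deltaBox (S.P.L ^ j) ((S.P.L ^ j : ℕ) • zOf p) p.μ p.ν) (μ ν : Fin S.P.d) :
    |curl (potZ S 𝔠 X h) x μ ν| ≤ amp S 𝔠 X j := by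
  rw [curl_potZ_eq_on_deltaBox S 𝔠 X h hk hR hadm hj hp hx]
  refine (abs_curl_patPot_le (L ^ j) (S.hL.1.pow) _ _ μ ν).trans ?_
  rw [abs_of_nonneg (amp_nonneg S 𝔠 hX0 (by omega))]

end Local

/-! ## §2 The averaged plaquette of the lift at a recorded plaquette, and its size -/

section Large

variable {X : Matrix (Fin 𝔊.N) (Fin 𝔊.N) ℂ} {k : ℕ} (h : Hist S.P k)

/-- The smallness hypothesis of the construction: `C68·g_jp(g_j) ≤ ¼` on the recorded scales. [cite: Balaban1985UV3, p.267 L7–8 («for g_{k−1} sufficiently small»)] -/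
def SmallOK (k : ℕ) : Prop := ∀ j, j < k → 𝔠.C68 * aj S 𝔠 j ≤ 1 / 4

/-- **THE FOUR BONDS OF `∂p′` HAVE TAME CONES** (F5a's sharp budget: `3·L²·(L^{j−1})²·amp j·‖X‖ = ¾·C68·g_jp(g_j) < log 2` for `j ≥ 1`; trivial at `j = 0`).
[cite: Balaban1985Averaging, (42)–(43) pp.23–24] -/
theorem coneTame_prof (hX0 : X ≠ 0) (hk : k ≤ S.K) (hR : CollarOK S 𝔠 k) (hsm : SmallOK S 𝔠 k)
    (hadm : Hist.Admissible 𝔠.lane.carrier.M₁ (rcolOf S 𝔠.lane.carrier) k h) {j : ℕ} (hj : j < k) {p : Plaq S.P j} (hp : p ∈ h ⟨j, hj⟩)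
    (z' : B7Prop1Explicit.Site S.P.d) (κ : Fin S.P.d)
    (hbox : ∀ x, ConeBox L j z' κ x → x ∈ deltaBox (S.P.L ^ j) ((S.P.L ^ j : ℕ) • zOf p) p.μ p.ν) :
    ConeTame L X (potZ S 𝔠 X h) j z' κ := by
  rcases Nat.eq_zero_or_pos j with rfl | hj1
  · trivial
  have hL1 : 1 ≤ L := le_of_lt S.hL.2
  have hXn : 0 < ‖X‖ := norm_pos_iff.2 hX0
  refine coneTame_of_curl_bound_sharp L hL1 X (potZ S 𝔠 X h) (amp_nonneg S 𝔠 hX0 (by omega)) j z' κ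
    (fun x hx μ ν => abs_curl_potZ_le_on_deltaBox S 𝔠 X h hX0 hk hR hadm hj hp (hbox x hx) μ ν) ?_
  -- the budget: `d L² (L^{j-1})² amp j ‖X‖ = 3 · C68 a_j / 4 < log 2`
  have hd : (S.P.d : ℝ) = 3 := by norm_num [show S.P.d = 3 from rfl]
  have hpow : (L : ℝ) ^ 2 * ((L : ℝ) ^ (j - 1)) ^ 2 = ((L : ℝ) ^ j) ^ 2 := by
    rw [← mul_pow, ← pow_succ', Nat.sub_add_cancel hj1]
  have hL0 : (0 : ℝ) < L := by exact_mod_cast (show 0 < L by omega)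
  have hval : (S.P.d : ℝ) * (L : ℝ) ^ 2 * (((L : ℝ) ^ (j - 1)) ^ 2 * amp S 𝔠 X j) * ‖X‖ = 3 * (𝔠.C68 * aj S 𝔠 j) / 4 := by
    rw [hd, show (3 : ℝ) * (L : ℝ) ^ 2 * (((L : ℝ) ^ (j - 1)) ^ 2 * amp S 𝔠 X j) = 3 * ((L : ℝ) ^ 2 * ((L : ℝ) ^ (j - 1)) ^ 2) * amp S 𝔠 X j by ring,
      hpow, amp]
    field_simp
  rw [hval]
  have hsj := hsm j hj
  have hlog : (0.6 : ℝ) < Real.log 2 := by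
    have := Real.log_two_gt_d9; linarith
  linarith

/-- **★ THE AVERAGED PLAQUETTE OF THE LIFT AT A RECORDED PLAQUETTE IS `exp(curl(linAvgIter potZ j)(z)·X)`.** [cite: Balaban1985Averaging, (43)–(44) p.24] -/
theorem hol_avgIter_prof (hX : X ∈ 𝔊.lie) (hX0 : X ≠ 0) (hk : k ≤ S.K) (hR : CollarOK S 𝔠 k) (hsm : SmallOK S 𝔠 k)
    (hadm : Hist.Admissible 𝔠.lane.carrier.M₁ (rcolOf S 𝔠.lane.carrier) k h) {j : ℕ} (hj : j < k) {p : Plaq S.P j} (hp : p ∈ h ⟨j, hj⟩) :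
    hol (avgIter L (liftCfg 𝔊 (prof S 𝔠 h hX)) j) (zOf p) (plaqWord p.μ p.ν) =
      expUnit (((curl (linAvgIter L (potZ S 𝔠 X h) j) (zOf p) p.μ p.ν : ℝ) : ℂ) • X) := by
  have hkm : k ≤ S.P.m + S.P.K := le_trans hk (Nat.le_add_left _ _)
  have hL1 : 1 ≤ L := le_of_lt S.hL.2
  have hPL : S.P.L = L := rfl
  have hμν : p.μ ≠ p.ν := ne_of_lt p.hμν
  rw [liftCfg_prof S 𝔠 h hX hkm]
  -- the four bonds have tame cones (their cone boxes lie in `Δ′(p′)`)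
  have hLj : (1 : ℤ) ≤ (L : ℤ) ^ j := by exact_mod_cast Nat.one_le_pow _ _ hL1
  have tame : ∀ (z' : B7Prop1Explicit.Site S.P.d) (κ : Fin S.P.d),
      (∀ i, zOf p i ≤ z' i ∧ z' i + (if i = κ then 1 else 0) ≤ zOf p i + (if i = p.μ ∨ i = p.ν then 1 else 0)) →
      ConeTame L X (potZ S 𝔠 X h) j z' κ := by
    intro z' κ hz'
    refine coneTame_prof S 𝔠 h hX0 hk hR hsm hadm hj hp z' κ fun x hx => mem_deltaBox_of_bounds S p fun i => ?_
    have h1 := hx i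
    have h2 := hz' i
    rw [hPL]
    constructor
    · nlinarith [h1.1, h2.1]
    · have h12 := h1.2; have h22 := h2.2
      split_ifs at h12 h22 ⊢ <;> nlinarith
  have t1 := tame (zOf p) p.μ fun i => by
    by_cases h1 : i = p.μ <;> by_cases h2 : i = p.ν <;> simp [h1, h2, hμν, hμν.symm]
  have t2 := tame (zOf p + e p.μ) p.ν fun i => by
    by_cases h1 : i = p.μ <;> by_cases h2 : i = p.ν <;> simp [h1, h2, hμν, hμν.symm, Pi.add_apply, e_apply]
  have t3 := tame (zOf p + e p.ν) p.μ fun i => by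
    by_cases h1 : i = p.μ <;> by_cases h2 : i = p.ν <;> simp [h1, h2, hμν, hμν.symm, Pi.add_apply, e_apply]
  have t4 := tame (zOf p) p.ν fun i => by
    by_cases h1 : i = p.μ <;> by_cases h2 : i = p.ν <;> simp [h1, h2, hμν, hμν.symm]
  rw [B7Prop1Local.hol_plaqWord_eq, avgIter_abelCfg L hL1 X _ j _ _ t1, avgIter_abelCfg L hL1 X _ j _ _ t2, avgIter_abelCfg L hL1 X _ j _ _ t3,
    avgIter_abelCfg L hL1 X _ j _ _ t4]
  simp only [abelCfg, inv_expUnit_smul, expUnit_smul_mul_expUnit_smul]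
  congr 2

/-- **★ ITS CURL IS THAT OF THE PURE PATTERN**: `|curl (linAvgIter potZ j)(zOf p′)| = amp j·((L^j)² + 1)/2`. [cite: Balaban1985UV3, (69)–(70) p.273] -/
theorem abs_curl_linAvgIter_potZ (X : Matrix (Fin 𝔊.N) (Fin 𝔊.N) ℂ) (hk : k ≤ S.K) (hR : CollarOK S 𝔠 k)
    (hadm : Hist.Admissible 𝔠.lane.carrier.M₁ (rcolOf S 𝔠.lane.carrier) k h) {j : ℕ} (hj : j < k) {p : Plaq S.P j} (hp : p ∈ h ⟨j, hj⟩) :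
    |curl (linAvgIter L (potZ S 𝔠 X h) j) (zOf p) p.μ p.ν| = |amp S 𝔠 X j| * ((((L : ℝ) ^ j) ^ 2 + 1) / 2) := by
  have hL1 : 1 ≤ L := le_of_lt S.hL.2
  have hPL : S.P.L = L := rfl
  rw [curl_linAvgIter_congr L hL1 p.μ p.ν j (zOf p) (a' := patPot (L ^ j) (amp S 𝔠 X j)) fun x hx =>
    curl_potZ_eq_on_deltaBox S 𝔠 X h hk hR hadm hj hp (mem_deltaBox_of_bounds S p fun i => ?_) p.μ p.ν]
  · exact abs_curl_linAvgIter_patPot S.hL.1 hL1 (show 1 ≤ S.P.d from by norm_num [show S.P.d = 3 from rfl]) _ j _ p.hμν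
  · have h1 := hx i
    have hμν : p.μ ≠ p.ν := ne_of_lt p.hμν
    have hLj : (1 : ℤ) ≤ (L : ℤ) ^ j := by exact_mod_cast Nat.one_le_pow _ _ hL1
    rw [hPL]
    refine ⟨h1.1, ?_⟩
    have h2 := h1.2
    by_cases hiμ : i = p.μ
    · rw [if_pos hiμ, if_neg (fun h' => hμν (hiμ.symm.trans h'))] at h2
      rw [if_pos (Or.inl hiμ)]; linarith
    · by_cases hiν : i = p.ν
      · rw [if_neg hiμ, if_pos hiν] at h2
        rw [if_pos (Or.inr hiν)]; linarith
      · rw [if_neg hiμ, if_neg hiν] at h2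
        rw [if_neg (not_or.2 ⟨hiμ, hiν⟩)]; linarith

/-- **★ THE PROFILE IS `h`-LARGE**: at every recorded plaquette `(j, p′)` of the admissible history, `|Ū^j(lift prof)(∂p′) − 1| ≥ g_jp(g_j)` — given `C68 ≥ 4π`,
`C68·g_jp(g_j) ≤ ¼` and collars `≥ 14` on the recorded scales. [cite: Balaban1985UV3, (40) p.266 + p.273 L13] -/
theorem hLarge_prof (hX : X ∈ 𝔊.lie) (hX0 : X ≠ 0) (hk : k ≤ S.K) (hR : CollarOK S 𝔠 k) (hsm : SmallOK S 𝔠 k) (hC : 4 * Real.pi ≤ 𝔠.C68)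
    (hadm : Hist.Admissible 𝔠.lane.carrier.M₁ (rcolOf S 𝔠.lane.carrier) k h) :
    HLarge S 𝔠.lane.carrier.b₀ 𝔠.lane.carrier.p₀ h (fun j => avgIter L (liftCfg 𝔊 (prof S 𝔠 h hX)) j) := by
  intro e' he'
  obtain ⟨⟨j, hj⟩, p, hp, rfl⟩ := (Hist.mem_disc h e').1 he'
  have hXn : 0 < ‖X‖ := norm_pos_iff.2 hX0
  have hskew := Summit.QuantumFields.Balaban3D.Proofs.GroupModelSkew.conjTranspose_eq_neg_of_mem_lie 𝔊 hX
  -- the recorded plaquette's position and the averaged plaquette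
  have hz : codeZ ((j : ℕ), plaqCode p) = zOf p := rfl
  show S.gk j * pFun 𝔠.lane.carrier.b₀ 𝔠.lane.carrier.p₀ (S.gk j) ≤ _
  rw [hz, show (plaqCode p).2.1 = p.μ from rfl, show (plaqCode p).2.2 = p.ν from rfl, hol_avgIter_prof S 𝔠 h hX hX0 hk hR hsm hadm hj hp, val_expUnit]
  set F : ℝ := curl (linAvgIter L (potZ S 𝔠 X h) j) (zOf p) p.μ p.ν with hF
  have hFabs : |F| = amp S 𝔠 X j * ((((L : ℝ) ^ j) ^ 2 + 1) / 2) := by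
    rw [hF, abs_curl_linAvgIter_potZ S 𝔠 h X hk hR hadm hj hp, abs_of_nonneg (amp_nonneg S 𝔠 hX0 (by omega))]
  -- sizes: `amp j · L^{2j} · ‖X‖ = C68 a_j / 4`
  have hLj : (1 : ℝ) ≤ ((L : ℝ) ^ j) ^ 2 := by
    have : (1 : ℝ) ≤ L := by exact_mod_cast le_of_lt S.hL.2
    exact one_le_pow₀ (one_le_pow₀ this)
  have hL0 : (0 : ℝ) < (L : ℝ) ^ j := by
    have : (0 : ℝ) < L := by exact_mod_cast lt_trans zero_lt_one S.hL.2
    positivity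
  have hampL : amp S 𝔠 X j * ((L : ℝ) ^ j) ^ 2 * ‖X‖ = 𝔠.C68 * aj S 𝔠 j / 4 := by
    unfold amp; field_simp
  have ha0 : 0 ≤ amp S 𝔠 X j := amp_nonneg S 𝔠 hX0 (by omega)
  have haj : 0 < aj S 𝔠 j := aj_pos S 𝔠 (by omega)
  have hsmall := hsm j hj
  -- `|F|‖X‖ ≤ amp L^{2j} ‖X‖ = C68 a_j/4 ≤ π`
  have hupper : |F| * ‖X‖ ≤ Real.pi := by
    rw [hFabs]
    have h1 : amp S 𝔠 X j * ((((L : ℝ) ^ j) ^ 2 + 1) / 2) * ‖X‖ ≤ amp S 𝔠 X j * ((L : ℝ) ^ j) ^ 2 * ‖X‖ := by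
      have : (((L : ℝ) ^ j) ^ 2 + 1) / 2 ≤ ((L : ℝ) ^ j) ^ 2 := by linarith
      gcongr
    have h2 : 𝔠.C68 * aj S 𝔠 j / 4 ≤ Real.pi := by linarith [Real.pi_gt_three]
    linarith [hampL]
  -- lower bound
  have hlow := abs_mul_norm_le_of_exp hskew hupper
  have hF2 : amp S 𝔠 X j * ((L : ℝ) ^ j) ^ 2 * ‖X‖ / 2 ≤ |F| * ‖X‖ := by
    rw [hFabs]
    have : ((L : ℝ) ^ j) ^ 2 / 2 ≤ (((L : ℝ) ^ j) ^ 2 + 1) / 2 := by linarith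
    have hx := mul_le_mul_of_nonneg_left this ha0
    nlinarith [norm_nonneg X]
  -- `a_j ≤ C68 a_j/(4π) ≤ (2/π)|F|‖X‖ ≤ ‖exp − 1‖`
  have hpi : 0 < Real.pi := Real.pi_pos
  have key : S.gk j * pFun 𝔠.lane.carrier.b₀ 𝔠.lane.carrier.p₀ (S.gk j) ≤ 2 / Real.pi * (|F| * ‖X‖) := by
    change aj S 𝔠 j ≤ _
    have h1 : aj S 𝔠 j ≤ 𝔠.C68 * aj S 𝔠 j / (4 * Real.pi) := by
      rw [le_div_iff₀ (by positivity)]; nlinarith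
    have h2 : 𝔠.C68 * aj S 𝔠 j / (4 * Real.pi) = 2 / Real.pi * (𝔠.C68 * aj S 𝔠 j / 4 / 2) := by field_simp
    rw [h2] at h1
    refine h1.trans (mul_le_mul_of_nonneg_left ?_ (by positivity))
    linarith [hampL]
  refine key.trans ?_
  rw [div_mul_eq_mul_div, div_le_iff₀ hpi]
  linarith

end Large

/-! ## §3 (b11‴) as a theorem: regular `h`-large profiles exist -/

/-- **★ (b11‴) AS A THEOREM — REGULAR `h`-LARGE PROFILES EXIST.**  For a group as printed with `X ∈ 𝔤 ∖ 0`, (68)'s constant `C68 ≥ 4π`, the smallness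
`C68·g_jp(g_j) ≤ ¼` and the collars `⌈R₁r(g_j)⌉M₁ ≥ 14` on the scales `j < K`: every ADMISSIBLE history `h` of `k ≤ K` steps is exhibited by a configuration of
[7]'s closed regular class `regClassC 𝔊 𝔠 k h` whose lifted `j`-fold averages (42)–(43) are `h`-LARGE.  This is the in-edge sentence gen 4 left displayed
(`…N08AlphaProfile`, hypothesis `hW`/`hWL` of `exists_externalInputs_faces₃_of_profile`), now proved for its admissible histories.
[cite: Balaban1985UV3, (40)–(42) p.266 + (67)–(68) p.273; Balaban1985Variational, (2)+(8) pp.278–279] -/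
theorem exists_regular_hLarge_profile (𝔊 : GroupModel G) (𝔠 : AlphaConsts L 𝔊.N) {X : Matrix (Fin 𝔊.N) (Fin 𝔊.N) ℂ} (hX : X ∈ 𝔊.lie) (hX0 : X ≠ 0)
    (hC : 4 * Real.pi ≤ 𝔠.C68) (hsm : ∀ j, j < S.K → 𝔠.C68 * (S.gk j * pFun 𝔠.lane.carrier.b₀ 𝔠.lane.carrier.p₀ (S.gk j)) ≤ 1 / 4)
    (hR : ∀ j, j < S.K → 14 ≤ rcolOf S 𝔠.lane.carrier j) {k : ℕ} (hk : k ≤ S.K) (h : Hist S.P k)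
    (hadm : Hist.Admissible 𝔠.lane.carrier.M₁ (rcolOf S 𝔠.lane.carrier) k h) :
    ∃ W : GaugeField S.P 0 G, W ∈ regClassC 𝔊 𝔠 k h ∧
      HLarge S 𝔠.lane.carrier.b₀ 𝔠.lane.carrier.p₀ h (fun j => avgIter L (liftCfg 𝔊 W) j) := by
  have hR' : CollarOK S 𝔠 k := fun j hj => by have := hR j (by omega); norm_num [R0]; omega
  have hsm' : SmallOK S 𝔠 k := fun j hj => hsm j (by omega)
  exact ⟨prof S 𝔠 h hX, prof_mem_regClassC S 𝔠 h hX hX0 hk hR', hLarge_prof S 𝔠 h hX hX0 hk hR' hsm' hC hadm⟩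

end Summit.QuantumFields.YangMills.Theorems.BalabanUVNodesN08AlphaProfileLarge

end
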